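import Mathlib

/-!
# Stub `stub_crossingLaplace` of line `crossing-split-integrability`
(crux `Summit.QuantumFields.QCD.Theses.PauliWegnerSea.PhaseQuenchedFlavourDecay` =
`Summit.QuantumFields.QCD.Theses.WilsonMobilityGap.PhaseQuenchedFlavourDecay`,
item stmt-QuantumFields-9151)

Generalised Laplace expansion by crossing matchings: a sign-free ("norm") Laplace expansion
along a `2`-partition (`crossingLaplace_normLaplace_cols`, from `MultilinearMap.map_add_univ` and
`Matrix.twoBlockTriangular_det`) is applied to the columns of `M` split by side and then to the
rows of the two resulting blocks; the small crossing blocks are bounded by the Leibniz formula and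
the `f₀`-charge is counted through the big `A × A` block by flavour balance.  `K = (r!)^5`.
-/

noncomputable section

namespace Summit.QuantumFields.QCD.Cruxes.PhaseQuenchedFlavourDecay.CrossingSplitIntegrability

/-! ### Leibniz-formula helpers -/

/-- If `det N ≠ 0` then some permutation `σ` picks only non-zero entries `N (σ a) a`
(Leibniz formula). -/
private theorem crossingLaplace_exists_perm_of_det_ne_zero {ι : Type*} [Fintype ι]
    [DecidableEq ι] {N : Matrix ι ι ℂ} (h : N.det ≠ 0) :
    ∃ σ : Equiv.Perm ι, ∀ a, N (σ a) a ≠ 0 := by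
  rw [Matrix.det_apply'] at h
  obtain ⟨σ, -, hσ⟩ := Finset.exists_ne_zero_of_sum_ne_zero h
  exact ⟨σ, fun a => Finset.prod_ne_zero_iff.mp (right_ne_zero_of_mul hσ) a (by simp)⟩

/-- Permuting the rows does not change the norm of a complex determinant. -/
private theorem crossingLaplace_norm_det_permute {ι : Type*} [Fintype ι] [DecidableEq ι]
    (N : Matrix ι ι ℂ) (σ : Equiv.Perm ι) : ‖(N.submatrix σ id).det‖ = ‖N.det‖ := by
  rw [Matrix.det_permute, norm_mul]
  rcases Int.units_eq_one_or (Equiv.Perm.sign σ) with h | h <;> simp [h]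

/-- **Small blocks.** A square complex matrix with all entries of norm `≤ η` has
`‖det‖ ≤ |J|! · η ^ |J|` (Leibniz formula). -/
private theorem crossingLaplace_norm_det_le {J : Type*} [Fintype J] [DecidableEq J]
    (A : Matrix J J ℂ) {η : ℝ} (hA : ∀ i j, ‖A i j‖ ≤ η) :
    ‖A.det‖ ≤ (Fintype.card J).factorial * η ^ Fintype.card J := by
  rw [Matrix.det_apply']
  calc ‖∑ σ : Equiv.Perm J, ((Equiv.Perm.sign σ : ℤ) : ℂ) * ∏ i, A (σ i) i‖
      ≤ ∑ σ : Equiv.Perm J, ‖((Equiv.Perm.sign σ : ℤ) : ℂ) * ∏ i, A (σ i) i‖ :=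
        norm_sum_le _ _
    _ ≤ ∑ _σ : Equiv.Perm J, η ^ Fintype.card J := by
        refine Finset.sum_le_sum fun σ _ => ?_
        have hsign : ‖((Equiv.Perm.sign σ : ℤ) : ℂ)‖ = 1 := by
          rcases Int.units_eq_one_or (Equiv.Perm.sign σ) with h | h <;> simp [h]
        rw [norm_mul, hsign, one_mul, norm_prod]
        calc ∏ i, ‖A (σ i) i‖ ≤ ∏ _i : J, η :=
              Finset.prod_le_prod (fun i _ => norm_nonneg _) fun i _ => hA _ _
          _ = η ^ Fintype.card J := by rw [Finset.prod_const, Finset.card_univ]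
    _ = (Fintype.card J).factorial * η ^ Fintype.card J := by
        rw [Finset.sum_const, Finset.card_univ, Fintype.card_perm, nsmul_eq_mul]

/-- **Flavour balance.** If `M a b = 0` whenever the flavours of `a` and `b` differ and the minor
`M[f, g]` has non-zero determinant, then for every flavour `f₀` the rows and the columns of the
minor carrying `f₀` are equinumerous (a non-vanishing Leibniz term is a flavour-preserving
bijection). -/
private theorem crossingLaplace_flavour_balance {r : ℕ} {Φ : Type} [DecidableEq Φ]
    {M : Matrix (Fin r) (Fin r) ℂ} {φr φc : Fin r → Φ} (hflav : ∀ a b, φr a ≠ φc b → M a b = 0)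
    {J : Type*} [Fintype J] [DecidableEq J] (f g : J → Fin r) (h : (M.submatrix f g).det ≠ 0)
    (f₀ : Φ) :
    (Finset.univ.filter fun a => φr (f a) = f₀).card =
      (Finset.univ.filter fun b => φc (g b) = f₀).card := by
  obtain ⟨τ, hτ⟩ := crossingLaplace_exists_perm_of_det_ne_zero h
  have hφ : ∀ a, φr (f (τ a)) = φc (g a) := fun a => not_not.mp fun hne => hτ a (hflav _ _ hne)
  refine Finset.card_equiv τ.symm fun a => ?_
  simp only [Finset.mem_filter, Finset.mem_univ, true_and]
  rw [← hφ, Equiv.apply_symm_apply]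

/-- **Covering count.** If every `a` with `P a` is an `f`-value or a `u`-value, then the `a` with
`Q a ∧ P a` number at most `#{x | Q (f x)} + |Y|`. -/
private theorem crossingLaplace_card_cover {X Y : Type*} [Fintype X] [Fintype Y] {r : ℕ}
    (f : X → Fin r) (u : Y → Fin r) (P Q : Fin r → Prop) [DecidablePred P] [DecidablePred Q]
    (hcov : ∀ a, P a → (∃ x, f x = a) ∨ ∃ y, u y = a) :
    (Finset.univ.filter fun a => Q a ∧ P a).card ≤
      (Finset.univ.filter fun x => Q (f x)).card + Fintype.card Y :=
  calc (Finset.univ.filter fun a => Q a ∧ P a).card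
      ≤ ((Finset.univ.filter fun x => Q (f x)).image f ∪ Finset.univ.image u).card := by
        refine Finset.card_le_card fun a ha => ?_
        simp only [Finset.mem_filter, Finset.mem_univ, true_and] at ha
        rcases hcov a ha.2 with ⟨x, rfl⟩ | ⟨y, rfl⟩
        · exact Finset.mem_union_left _ (Finset.mem_image_of_mem f (by simpa using ha.1))
        · exact Finset.mem_union_right _ (Finset.mem_image_of_mem u (Finset.mem_univ y))
    _ ≤ _ := Finset.card_union_le _ _
    _ ≤ _ := add_le_add Finset.card_image_le (Finset.card_image_le.trans_eq Finset.card_univ)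

/-! ### The norm-Laplace expansion along a `2`-partition -/

/-- **Norm-Laplace expansion along a column `2`-partition.** For a column predicate `p`,
`‖det N‖` is at most the sum over row permutations `σ` of `‖det N[σ p, p]‖ * ‖det N[σ pᶜ, pᶜ]‖`.
Proof: split every row into its `p`-part and its `pᶜ`-part and expand by multilinearity
(`MultilinearMap.map_add_univ`); a piece with non-zero determinant has a non-vanishing Leibniz
term, i.e. a permutation `τ` matching its `p`-supported rows with `p`, and after permuting the
rows by `τ` the piece is block triangular (`Matrix.twoBlockTriangular_det`).  No signs are
tracked. -/
private theorem crossingLaplace_normLaplace_cols {ι : Type*} [Fintype ι] [DecidableEq ι]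
    (N : Matrix ι ι ℂ) (p : ι → Prop) [DecidablePred p] :
    ‖N.det‖ ≤ ∑ σ : Equiv.Perm ι,
      ‖(N.submatrix (fun a : {x // p x} => σ a.1) (fun b : {x // p x} => b.1)).det‖ *
        ‖(N.submatrix (fun a : {x // ¬p x} => σ a.1) (fun b : {x // ¬p x} => b.1)).det‖ := by
  obtain ⟨F, hF⟩ : ∃ F : Equiv.Perm ι → ℝ, ∀ σ, F σ =
      ‖(N.submatrix (fun a : {x // p x} => σ a.1) (fun b : {x // p x} => b.1)).det‖ *
        ‖(N.submatrix (fun a : {x // ¬p x} => σ a.1) (fun b : {x // ¬p x} => b.1)).det‖ :=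
    ⟨_, fun σ => rfl⟩
  have hF0 : ∀ σ, 0 ≤ F σ := fun σ => by rw [hF]; positivity
  suffices hmain : ‖N.det‖ ≤ ∑ σ, F σ by simpa only [hF] using hmain
  -- the two halves of each row
  obtain ⟨rowA, hA⟩ : ∃ R : Matrix ι ι ℂ, R = Matrix.of fun a b => if p b then N a b else 0 :=
    ⟨_, rfl⟩
  obtain ⟨rowB, hB⟩ : ∃ R : Matrix ι ι ℂ, R = Matrix.of fun a b => if p b then 0 else N a b :=
    ⟨_, rfl⟩
  have hsplit : N = rowA + rowB := by
    ext a b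
    rw [hA, hB, Matrix.add_apply, Matrix.of_apply, Matrix.of_apply]
    split_ifs <;> simp
  -- the image of the `p`-indices under a permutation
  obtain ⟨g, hg⟩ : ∃ g : Equiv.Perm ι → Finset ι, ∀ σ, g σ = (Finset.univ.filter p).image σ :=
    ⟨_, fun σ => rfl⟩
  -- multilinearity of `det` in the rows
  have hdet : N.det = ∑ s : Finset ι, (Matrix.of (s.piecewise rowA rowB)).det := by
    have h := (Matrix.detRowAlternating : (ι → ℂ) [⋀^ι]→ₗ[ℂ] ℂ).toMultilinearMap.map_add_univ
      rowA rowB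
    rw [hsplit]
    exact h
  -- each piece is bounded by its fibre of the final sum
  have hstep : ∀ s : Finset ι,
      ‖(Matrix.of (s.piecewise rowA rowB)).det‖ ≤ ∑ σ, if g σ = s then F σ else 0 := by
    intro s
    have hnn : ∀ σ, (0 : ℝ) ≤ if g σ = s then F σ else 0 := fun σ => by
      split_ifs <;> [exact hF0 σ; exact le_rfl]
    by_cases h0 : (Matrix.of (s.piecewise rowA rowB)).det = 0
    · rw [h0, norm_zero]
      exact Finset.sum_nonneg fun σ _ => hnn σ
    obtain ⟨τ, hτ⟩ := crossingLaplace_exists_perm_of_det_ne_zero h0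
    have hgood : ∀ a, τ a ∈ s ↔ p a := by
      intro a
      have h1 := hτ a
      simp only [Matrix.of_apply, Finset.piecewise, ite_apply, hA, hB] at h1
      by_cases h2 : τ a ∈ s <;> by_cases h3 : p a <;> simp [h2, h3] at h1 ⊢
    have hgτ : g τ = s := by
      ext x
      simp only [hg, Finset.mem_image, Finset.mem_filter, Finset.mem_univ, true_and]
      constructor
      · rintro ⟨a, ha, rfl⟩
        exact (hgood a).2 ha
      · intro hx
        exact ⟨τ.symm x, (hgood _).1 (by simpa using hx), by simp⟩
    have hX : Matrix.toSquareBlockProp ((Matrix.of (s.piecewise rowA rowB)).submatrix τ id) p =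
        N.submatrix (fun a : {x // p x} => τ a.1) (fun b : {x // p x} => b.1) := by
      ext a b
      simp [Matrix.toSquareBlockProp_def, Finset.piecewise, ite_apply, (hgood _).2 a.2, hA, b.2]
    have hZ : Matrix.toSquareBlockProp ((Matrix.of (s.piecewise rowA rowB)).submatrix τ id)
        (fun i => ¬p i) =
        N.submatrix (fun a : {x // ¬p x} => τ a.1) (fun b : {x // ¬p x} => b.1) := by
      ext a b
      have ha : τ a.1 ∉ s := fun h => a.2 ((hgood _).1 h)
      simp [Matrix.toSquareBlockProp_def, Finset.piecewise, ite_apply, ha, hB, b.2]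
    have hblock : ‖(Matrix.of (s.piecewise rowA rowB)).det‖ = F τ := by
      rw [← crossingLaplace_norm_det_permute _ τ, Matrix.twoBlockTriangular_det _ p, norm_mul,
        hX, hZ, hF]
      intro i hi j hj
      have hi' : τ i ∉ s := fun h => hi ((hgood i).1 h)
      simp [Finset.piecewise, hi', hB, hj]
    rw [hblock]
    calc F τ = if g τ = s then F τ else 0 := by rw [if_pos hgτ]
      _ ≤ ∑ σ, if g σ = s then F σ else 0 :=
        Finset.single_le_sum (fun σ _ => hnn σ) (Finset.mem_univ τ)
  calc ‖N.det‖ = ‖∑ s : Finset ι, (Matrix.of (s.piecewise rowA rowB)).det‖ := by rw [hdet]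
    _ ≤ ∑ s : Finset ι, ‖(Matrix.of (s.piecewise rowA rowB)).det‖ := norm_sum_le _ _
    _ ≤ ∑ s : Finset ι, ∑ σ, if g σ = s then F σ else 0 := Finset.sum_le_sum fun s _ => hstep s
    _ = ∑ σ, ∑ s : Finset ι, if g σ = s then F σ else 0 := Finset.sum_comm
    _ = ∑ σ, F σ := Finset.sum_congr rfl fun σ _ => by simp

/-- Row version of `crossingLaplace_normLaplace_cols` (through the transpose): for a row
predicate `p`, `‖det N‖ ≤ ∑_σ ‖det N[p, σ p]‖ * ‖det N[pᶜ, σ pᶜ]‖`. -/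
private theorem crossingLaplace_normLaplace_rows {ι : Type*} [Fintype ι] [DecidableEq ι]
    (N : Matrix ι ι ℂ) (p : ι → Prop) [DecidablePred p] :
    ‖N.det‖ ≤ ∑ σ : Equiv.Perm ι,
      ‖(N.submatrix (fun a : {x // p x} => a.1) (fun b : {x // p x} => σ b.1)).det‖ *
        ‖(N.submatrix (fun a : {x // ¬p x} => a.1) (fun b : {x // ¬p x} => σ b.1)).det‖ := by
  simpa only [← Matrix.transpose_submatrix, Matrix.det_transpose] using
    crossingLaplace_normLaplace_cols N.transpose p

/-! ### One term of the triple expansion -/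

/-- **One term of the triple expansion.** Given an `A × A` minor `M[f, g]` (injective
enumerations), two crossing blocks `C₂`, `C₃` with entries of norm `≤ η ≤ 1`, a `B × B` minor
`M[f', g']`, and the covering property "every side-`A` row is a row of `M[f, g]` or of `C₃`,
every side-`A` column is a column of `M[f, g]` or of `C₂`", the product of the four determinant
norms is at most `(r!)² η^{|q|} S`: the crossing blocks give `(r!)² η^{|C₂| + |C₃|}`, flavour
balance in `M[f, g]` gives `|q| ≤ |C₂| + |C₃|`, and the two big minors form one term of the
sink `S`. -/
private theorem crossingLaplace_term {r : ℕ} {Φ : Type} [DecidableEq Φ]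
    {M : Matrix (Fin r) (Fin r) ℂ} {φr φc : Fin r → Φ} {sr sc : Fin r → Bool} {f₀ : Φ} {η S : ℝ}
    (hη0 : 0 ≤ η) (hη1 : η ≤ 1) (hflav : ∀ a b, φr a ≠ φc b → M a b = 0)
    (hS : ∀ (n n' : ℕ) (f g : Fin n → Fin r) (f' g' : Fin n' → Fin r), n ≤ r → n' ≤ r →
      (∀ t, sr (f t) = true) → (∀ t, sc (g t) = true) → (∀ t, sr (f' t) = false) →
      (∀ t, sc (g' t) = false) → ‖(M.submatrix f g).det‖ * ‖(M.submatrix f' g').det‖ ≤ S)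
    {J J₂ J₃ J' : Type} [Fintype J] [DecidableEq J] [Fintype J₂] [DecidableEq J₂]
    [Fintype J₃] [DecidableEq J₃] [Fintype J'] [DecidableEq J']
    {f g : J → Fin r} (hf : ∀ a, sr (f a) = true) (hg : ∀ b, sc (g b) = true)
    (hfi : Function.Injective f) (hgi : Function.Injective g)
    {C₂ : Matrix J₂ J₂ ℂ} (hC₂ : ∀ a b, ‖C₂ a b‖ ≤ η) (hJ₂ : Fintype.card J₂ ≤ r)
    {C₃ : Matrix J₃ J₃ ℂ} (hC₃ : ∀ a b, ‖C₃ a b‖ ≤ η) (hJ₃ : Fintype.card J₃ ≤ r)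
    {f' g' : J' → Fin r} (hf' : ∀ a, sr (f' a) = false) (hg' : ∀ b, sc (g' b) = false)
    (hJ : Fintype.card J ≤ r) (hJ' : Fintype.card J' ≤ r)
    (u : J₃ → Fin r) (hcovR : ∀ a, sr a = true → (∃ x, f x = a) ∨ ∃ y, u y = a)
    (v : J₂ → Fin r) (hcovC : ∀ b, sc b = true → (∃ x, g x = b) ∨ ∃ y, v y = b) :
    ‖(M.submatrix f g).det‖ * ‖C₂.det‖ * (‖C₃.det‖ * ‖(M.submatrix f' g').det‖) ≤
      r.factorial * r.factorial *
        η ^ (((Finset.univ.filter fun a => φr a = f₀ ∧ sr a = true).card : ℤ) -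
          ((Finset.univ.filter fun b => φc b = f₀ ∧ sc b = true).card : ℤ)).natAbs * S := by
  -- the two small crossing blocks
  have h₂ : ‖C₂.det‖ ≤ r.factorial * η ^ Fintype.card J₂ :=
    (crossingLaplace_norm_det_le C₂ hC₂).trans (by gcongr)
  have h₃ : ‖C₃.det‖ ≤ r.factorial * η ^ Fintype.card J₃ :=
    (crossingLaplace_norm_det_le C₃ hC₃).trans (by gcongr)
  -- the two big blocks form one term of `S`
  have hAB : ‖(M.submatrix f g).det‖ * ‖(M.submatrix f' g').det‖ ≤ S := by
    have h := hS _ _ (f ∘ (Fintype.equivFin J).symm) (g ∘ (Fintype.equivFin J).symm)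
      (f' ∘ (Fintype.equivFin J').symm) (g' ∘ (Fintype.equivFin J').symm) hJ hJ'
      (fun t => hf _) (fun t => hg _) (fun t => hf' _) (fun t => hg' _)
    rwa [← Matrix.submatrix_submatrix, Matrix.det_submatrix_equiv_self,
      ← Matrix.submatrix_submatrix, Matrix.det_submatrix_equiv_self] at h
  -- charge count: `|q| ≤ |J₂| + |J₃|` unless the `A × A` minor is singular
  have hcharge : ‖(M.submatrix f g).det‖ * (η ^ Fintype.card J₂ * η ^ Fintype.card J₃) ≤
      ‖(M.submatrix f g).det‖ *
        η ^ (((Finset.univ.filter fun a => φr a = f₀ ∧ sr a = true).card : ℤ) -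
          ((Finset.univ.filter fun b => φc b = f₀ ∧ sc b = true).card : ℤ)).natAbs := by
    by_cases h0 : (M.submatrix f g).det = 0
    · simp [h0]
    refine mul_le_mul_of_nonneg_left ?_ (norm_nonneg _)
    rw [← pow_add]
    refine pow_le_pow_of_le_one hη0 hη1 ?_
    have hL := crossingLaplace_flavour_balance hflav f g h0 f₀
    have hi : (Finset.univ.filter fun a => φr (f a) = f₀).card ≤
        (Finset.univ.filter fun a => φr a = f₀ ∧ sr a = true).card :=
      Finset.card_le_card_of_injOn f (fun a ha => by simpa [hf a] using ha) hfi.injOn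
    have hii : (Finset.univ.filter fun a => φr a = f₀ ∧ sr a = true).card ≤
        (Finset.univ.filter fun a => φr (f a) = f₀).card + Fintype.card J₃ :=
      crossingLaplace_card_cover f u _ _ hcovR
    have hiii : (Finset.univ.filter fun b => φc (g b) = f₀).card ≤
        (Finset.univ.filter fun b => φc b = f₀ ∧ sc b = true).card :=
      Finset.card_le_card_of_injOn g (fun b hb => by simpa [hg b] using hb) hgi.injOn
    have hiv : (Finset.univ.filter fun b => φc b = f₀ ∧ sc b = true).card ≤
        (Finset.univ.filter fun b => φc (g b) = f₀).card + Fintype.card J₂ :=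
      crossingLaplace_card_cover g v _ _ hcovC
    omega
  -- assemble
  calc ‖(M.submatrix f g).det‖ * ‖C₂.det‖ * (‖C₃.det‖ * ‖(M.submatrix f' g').det‖)
      = ‖(M.submatrix f g).det‖ * (‖C₂.det‖ * ‖C₃.det‖) * ‖(M.submatrix f' g').det‖ := by ring
    _ ≤ ‖(M.submatrix f g).det‖ * (r.factorial * η ^ Fintype.card J₂ *
          (r.factorial * η ^ Fintype.card J₃)) * ‖(M.submatrix f' g').det‖ := by gcongr
    _ = r.factorial * r.factorial *
          (‖(M.submatrix f g).det‖ * (η ^ Fintype.card J₂ * η ^ Fintype.card J₃)) *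
          ‖(M.submatrix f' g').det‖ := by ring
    _ ≤ r.factorial * r.factorial * (‖(M.submatrix f g).det‖ *
          η ^ (((Finset.univ.filter fun a => φr a = f₀ ∧ sr a = true).card : ℤ) -
            ((Finset.univ.filter fun b => φc b = f₀ ∧ sc b = true).card : ℤ)).natAbs) *
          ‖(M.submatrix f' g').det‖ :=
        mul_le_mul_of_nonneg_right (mul_le_mul_of_nonneg_left hcharge (by positivity))
          (norm_nonneg _)
    _ = r.factorial * r.factorial *
          η ^ (((Finset.univ.filter fun a => φr a = f₀ ∧ sr a = true).card : ℤ) -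
            ((Finset.univ.filter fun b => φc b = f₀ ∧ sc b = true).card : ℤ)).natAbs *
          (‖(M.submatrix f g).det‖ * ‖(M.submatrix f' g').det‖) := by ring
    _ ≤ _ := by gcongr

/-! ### The triple expansion -/

/-- **Triple expansion.** Under the flavour and crossing hypotheses,
`‖det M‖ ≤ η^{|q|} (r!)^5 S` for every non-negative sink `S` dominating every product of an
`A × A` minor norm and a `B × B` minor norm: expand along the side partition of the columns
(`crossingLaplace_normLaplace_cols`), then along the side partition of the rows of each block
(`crossingLaplace_normLaplace_rows`), and bound each of the at most `(r!)^3` terms by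
`crossingLaplace_term`. -/
private theorem crossingLaplace_core {r : ℕ} {Φ : Type} [DecidableEq Φ]
    (M : Matrix (Fin r) (Fin r) ℂ) (φr φc : Fin r → Φ) (sr sc : Fin r → Bool) (f₀ : Φ)
    {η S : ℝ} (hη0 : 0 ≤ η) (hη1 : η ≤ 1) (hflav : ∀ a b, φr a ≠ φc b → M a b = 0)
    (hcross : ∀ a b, sr a ≠ sc b → ‖M a b‖ ≤ η) (hS0 : 0 ≤ S)
    (hS : ∀ (n n' : ℕ) (f g : Fin n → Fin r) (f' g' : Fin n' → Fin r), n ≤ r → n' ≤ r →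
      (∀ t, sr (f t) = true) → (∀ t, sc (g t) = true) → (∀ t, sr (f' t) = false) →
      (∀ t, sc (g' t) = false) → ‖(M.submatrix f g).det‖ * ‖(M.submatrix f' g').det‖ ≤ S) :
    ‖M.det‖ ≤ η ^ (((Finset.univ.filter fun a => φr a = f₀ ∧ sr a = true).card : ℤ) -
        ((Finset.univ.filter fun b => φc b = f₀ ∧ sc b = true).card : ℤ)).natAbs *
      (r.factorial : ℝ) ^ 5 * S := by
  -- cardinalities of (nested) subtypes of `Fin r` and of their permutation groups
  have hcard : ∀ (q : Fin r → Prop) [DecidablePred q], Fintype.card {x // q x} ≤ r :=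
    fun q _ => (Fintype.card_subtype_le q).trans_eq (Fintype.card_fin r)
  have hcard2 : ∀ (q : Fin r → Prop) [DecidablePred q] (q' : {x // q x} → Prop)
      [DecidablePred q'], Fintype.card {y : {x // q x} // q' y} ≤ r :=
    fun q _ q' _ => (Fintype.card_subtype_le q').trans (hcard q)
  have hperm : ∀ (q : Fin r → Prop) [DecidablePred q],
      (Fintype.card (Equiv.Perm {x // q x}) : ℝ) ≤ r.factorial := fun q _ => by
    rw [Fintype.card_perm]
    exact_mod_cast Nat.factorial_le (hcard q)
  have hperm0 : (Fintype.card (Equiv.Perm (Fin r)) : ℝ) ≤ r.factorial := by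
    rw [Fintype.card_perm, Fintype.card_fin]
  -- step 1: columns split by side; step 2: rows of each of the two blocks split by side
  have step2 : ∀ σ : Equiv.Perm (Fin r), _ := fun σ => mul_le_mul
    (crossingLaplace_normLaplace_rows
      (M.submatrix (fun a : {x // sc x = true} => σ a.1) fun b : {x // sc x = true} => b.1)
      fun y => sr (σ y.1) = true)
    (crossingLaplace_normLaplace_rows
      (M.submatrix (fun a : {x // ¬sc x = true} => σ a.1) fun b : {x // ¬sc x = true} => b.1)
      fun y => sr (σ y.1) = true)
    (norm_nonneg _) (Finset.sum_nonneg fun _ _ => by positivity)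
  refine le_trans (crossingLaplace_normLaplace_cols M fun b => sc b = true) ?_
  refine le_trans (Finset.sum_le_sum fun σ _ => step2 σ) ?_
  simp only [Finset.sum_mul_sum, Matrix.submatrix_submatrix, Function.comp_def]
  calc _ ≤ ∑ _σ : Equiv.Perm (Fin r), ∑ _π : Equiv.Perm {x // sc x = true},
        ∑ _ρ : Equiv.Perm {x // ¬sc x = true}, (r.factorial : ℝ) * r.factorial *
          η ^ (((Finset.univ.filter fun a => φr a = f₀ ∧ sr a = true).card : ℤ) -
            ((Finset.univ.filter fun b => φc b = f₀ ∧ sc b = true).card : ℤ)).natAbs * S := ?_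
    _ ≤ _ := ?_
  · refine Finset.sum_le_sum fun σ _ => Finset.sum_le_sum fun π _ =>
      Finset.sum_le_sum fun ρ _ => ?_
    -- step 3: one term
    refine crossingLaplace_term hη0 hη1 hflav hS ?_ ?_ ?_ ?_ ?_ ?_ ?_ ?_ ?_ ?_ ?_ ?_ ?_ ?_ ?_ ?_
    · exact fun a => a.2
    · exact fun b => (π b.1).2
    · exact fun a b h => Subtype.ext (Subtype.ext (σ.injective h))
    · exact fun a b h => Subtype.ext (π.injective (Subtype.ext h))
    · exact fun a b => hcross _ _ fun h => a.2 (h.trans (π b.1).2)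
    · exact hcard2 _ _
    · exact fun a b => hcross _ _ fun h => (ρ b.1).2 (h.symm.trans a.2)
    · exact hcard2 _ _
    · exact fun a => by simpa using a.2
    · exact fun b => by simpa using (ρ b.1).2
    · exact hcard2 _ _
    · exact hcard2 _ _
    · exact fun y => σ y.1.1
    · -- every side-`A` row is a row of the `A × A` minor or of the crossing block `C₃`
      intro a ha
      by_cases hx : sc (σ.symm a) = true
      · exact Or.inl ⟨⟨⟨σ.symm a, hx⟩, by simpa using ha⟩, by simp⟩
      · exact Or.inr ⟨⟨⟨σ.symm a, hx⟩, by simpa using ha⟩, by simp⟩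
    · exact fun y => (π y.1).1
    · -- every side-`A` column is a column of the `A × A` minor or of the crossing block `C₂`
      intro b hb
      by_cases hy : sr (σ (π.symm ⟨b, hb⟩).1) = true
      · exact Or.inl ⟨⟨π.symm ⟨b, hb⟩, hy⟩, by simp⟩
      · exact Or.inr ⟨⟨π.symm ⟨b, hb⟩, hy⟩, by simp⟩
  · -- at most `(r!)^3` terms
    simp only [Finset.sum_const, Finset.card_univ, nsmul_eq_mul]
    refine (mul_le_mul hperm0 (mul_le_mul (hperm _) (mul_le_mul_of_nonneg_right (hperm _)
      (by positivity)) (by positivity) (by positivity)) (by positivity) (by positivity)).trans_eq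
      ?_
    ring

/-- A non-negative family is bounded below termwise by its sum. -/
private theorem crossingLaplace_le_sum {α : Type*} [Fintype α] {F : α → ℝ} (hF : ∀ a, 0 ≤ F a)
    (a : α) : F a ≤ ∑ x, F x :=
  Finset.single_le_sum (fun x _ => hF x) (Finset.mem_univ a)

/-- Registered stub `stub_crossingLaplace` of line `crossing-split-integrability` for crux
stmt-QuantumFields-9151: generalised Laplace expansion by crossing matchings,
`‖det M‖ ≤ η^{|q|} · K · S` with `K = (r!)^5` (`crossingLaplace_core` with `S` instantiated). -/
theorem stub_crossingLaplace :
    ∀ r : ℕ, ∃ K : ℝ, 0 ≤ K ∧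
      ∀ (Φ : Type) [DecidableEq Φ] (M : Matrix (Fin r) (Fin r) ℂ) (φr φc : Fin r → Φ) (sr sc : Fin r → Bool)
        (f₀ : Φ) (η : ℝ), 0 ≤ η → η ≤ 1 →
        (∀ a b, φr a ≠ φc b → M a b = 0) →
        (∀ a b, sr a ≠ sc b → ‖M a b‖ ≤ η) →
          ‖M.det‖ ≤
            η ^ (((Finset.univ.filter fun a => φr a = f₀ ∧ sr a = true).card : ℤ) -
                  ((Finset.univ.filter fun b => φc b = f₀ ∧ sc b = true).card : ℤ)).natAbs * K *
              ∑ i : Fin (r + 1), ∑ j : Fin (r + 1),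
                ∑ e₁ : Fin (i : ℕ) → {a // sr a = true}, ∑ e₂ : Fin (i : ℕ) → {b // sc b = true},
                  ∑ e₃ : Fin (j : ℕ) → {a // sr a = false}, ∑ e₄ : Fin (j : ℕ) → {b // sc b = false},
                    ‖(M.submatrix (fun t => (e₁ t).1) (fun t => (e₂ t).1)).det‖ *
                      ‖(M.submatrix (fun t => (e₃ t).1) (fun t => (e₄ t).1)).det‖ := by
  intro r
  refine ⟨(r.factorial : ℝ) ^ 5, by positivity, ?_⟩
  intro Φ _ M φr φc sr sc f₀ η hη0 hη1 hflav hcross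
  refine crossingLaplace_core M φr φc sr sc f₀ hη0 hη1 hflav hcross (by positivity) ?_
  intro n n' f g f' g' hn hn' hf hg hf' hg'
  -- the pair `(M[f, g], M[f', g'])` is the term `i = n`, `j = n'`, `e = (f, g, f', g')` of `S`
  refine le_trans ?_ (crossingLaplace_le_sum (fun _ => by positivity)
    (⟨n, Nat.lt_succ_of_le hn⟩ : Fin (r + 1)))
  refine le_trans ?_ (crossingLaplace_le_sum (fun _ => by positivity)
    (⟨n', Nat.lt_succ_of_le hn'⟩ : Fin (r + 1)))
  refine le_trans ?_ (crossingLaplace_le_sum (fun _ => by positivity)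
    fun t => (⟨f t, hf t⟩ : {a // sr a = true}))
  refine le_trans ?_ (crossingLaplace_le_sum (fun _ => by positivity)
    fun t => (⟨g t, hg t⟩ : {b // sc b = true}))
  refine le_trans ?_ (crossingLaplace_le_sum (fun _ => by positivity)
    fun t => (⟨f' t, hf' t⟩ : {a // sr a = false}))
  refine le_trans ?_ (crossingLaplace_le_sum (fun _ => by positivity)
    fun t => (⟨g' t, hg' t⟩ : {b // sc b = false}))
  exact le_rfl

end Summit.QuantumFields.QCD.Cruxes.PhaseQuenchedFlavourDecay.CrossingSplitIntegrability

end
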